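import Summits.AtomisticToContinuum.HydrodynamicLimit.Theorems.CollisionIsometryCLTCollisionalTransferLocalityDefsB
import HarnessLib

/-!
# Vocabulary of the line `hemisphere-affine-slaving`, part C: the flux form of the collision-jump sum
(crux `CollisionalTransferLocality`, stmt-AtomisticToContinuum-9518; rank 3 of route
`StiffCollisionalRelaxation`, rank 4 of `CollisionIsometryCLT` — the two route decls are `rfl`-equal)

Definitions-only support file (`--supports stmt-AtomisticToContinuum-9518`) of the line lead (gen 1, seat c2),
continuing `…CollisionalTransferLocalityDefs` (p77328) and `…DefsB`. It makes importable the vocabulary in which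
the registered research stub [A'] `stub_fluxMomentChaosDilute` (raw two-flux-moment chaos at contact:
`J_N − Sraw_N → 0`) is RESHAPED into a PROVED deterministic layer and two sharper open stubs:

  [A'] ⟸ [A'-kin] (landing: `|J_N − M_N| ≤ 27 C₂ ε_N · V_N` pathwise on the good set — the Taylor step
          `ψ(x_i) − ψ(x_j) = ε_N (ω·∇)ψ + O(ε_N²)` taken collision by collision)
        ∧ [V] `VirialTight` (the weighted collision virial `V_N(t)` is bounded in probability — a-priori family)
        ∧ [A'-chaos] `FluxFormChaos` (`M_N − Sraw_N → 0`: the `‖Δv‖`-weighted empirical law of the collision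
          marks `(ω, v, v_*)`, tested against the two polynomial mark factors `ω⊗ω` and `(V·ω)ω` with the test
          GRADIENTS as coefficients, equals block by block its chaos average — the pure chaos content).

* `sepV`, `omg`, `Vcm` — separation vector `n = x_i − x_j` (minimal image), unit normal `ω = n/‖n‖`, pair
  centre-of-mass velocity `V = (v_i + v_j)/2` of an ordered pair;
* `markK σ ψ χ N s w i j = (ε_N/2)‖Δv_i‖ [ω⊗ω : ∇ψ(s, x_i) + (V·ω)(ω·∇χ(s, x_i))]` — the FLUX-FORM MARK KERNEL
  (the collision keeps its time, place, normal, flux weight `‖Δv_i‖ = |g·ω|` and velocities; only the finite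
  difference of the tests is replaced by their gradients at `x_i`), and its normalised collision sum `Mfun`;
* `virialK σ N s w i j = ε_N ‖Δv_i‖ (1 + ‖v_i‖ + ‖v_j‖)`, `virialW` — the WEIGHTED COLLISION VIRIAL `V_N(z, τ)`;
* `VirialTight`, `FluxFormChaos` — the statements [V] and [A'-chaos] at one `(σ, profiles, Φ, (kernel,) t(, ψ, χ))`.
Nothing in this file is asserted: every `def … : Prop` is a predicate the stubs prove or consume.
-/

namespace Summit.AtomisticToContinuum.HydrodynamicLimit.Theorems.HemisphereAffineSlaving

open scoped BigOperators Topology Classical ENNReal InnerProductSpace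
open Filter Set Function MeasureTheory

noncomputable section

open Literature.MathematicalPhysics.KineticTheory (T3 V3)

/-! ## Pair geometry -/

/-- The separation vector `n = x_i − x_j` (minimal image on `𝕋³`) of the ordered pair `(i, j)` of the
configuration `w` — the vector at which `dV`/`dE` reflect the velocities. -/
def sepV (N : ℕ) (w : Cfg N) (i j : Fin (N + 1)) : V3 :=
  (Literature.Analysis.FluidPDE.Torus.geometry (Fin 3)).sepVec (w i).1 (w j).1

/-- The unit contact normal `ω = n/‖n‖` of the ordered pair `(i, j)` (junk `0` at `n = 0`); at a contact
pair `‖n‖ = ε_N` and `Δv_i = ⟪v_i − v_j, ω⟫ ω`. -/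
def omg (N : ℕ) (w : Cfg N) (i j : Fin (N + 1)) : V3 :=
  ‖sepV N w i j‖⁻¹ • sepV N w i j

/-- The centre-of-mass velocity `V = (v_i + v_j)/2` of the pair (invariant under the elastic collision;
`Δ(|v_i|²/2) = ⟪v_i − v_j, ω⟫ ⟪V, ω⟫`). -/
def Vcm (N : ℕ) (w : Cfg N) (i j : Fin (N + 1)) : V3 :=
  (1 / 2 : ℝ) • ((w i).2 + (w j).2)

/-! ## The flux-form mark kernel and its collision sum -/

/-- FLUX-FORM MARK KERNEL per ordered contact pair:
`(ε_N/2) · ‖Δv_i‖ · [Σ_ab ω_a ω_b ∂_b ψ_a (s, x_i) + ⟪V, ω⟫ Σ_a ω_a ∂_a χ (s, x_i)]` — to be compared with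
`rawK = (ε_N/2) ‖Δv_i‖ · chaosAvg (s, x_i)` (same collision, mark factor replaced by its block chaos average)
and with the exact `jumpK` (whose pair sum is `⟪v_i − v_j, ω⟫ (⟪ψ(x_i) − ψ(x_j), ω⟫ + (χ(x_i) − χ(x_j))⟪V, ω⟫)`). -/
def markK (σ : ℝ) (ψ : ℝ → T3 → V3) (χ : ℝ → T3 → ℝ) (N : ℕ) (s : ℝ) (w : Cfg N)
    (i j : Fin (N + 1)) : ℝ :=
  Literature.MathematicalPhysics.KineticTheory.hsDiameter σ N / 2 * ‖dV N w i j‖ *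
    ((∑ a, ∑ b, omg N w i j a * omg N w i j b * gradPsi ψ s (w i).1 a b) +
      ⟪Vcm N w i j, omg N w i j⟫_ℝ * ∑ a, omg N w i j a * gradChi χ s (w i).1 a)

/-- `M_N(z, τ)`: the flux-form mark sum over the ordered contact pairs of the orbit of `z` with collision
times in `(0, τ]`, normalised by `(N+1)⁻¹` (same shape as `Jfun`, `Sraw`, `Sfun`). -/
def Mfun (σ : ℝ) (Φ : Flows σ) (ψ : ℝ → T3 → V3) (χ : ℝ → T3 → ℝ) (N : ℕ) (z : Cfg N)
    (τ : ℝ) : ℝ :=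
  ((N : ℝ) + 1)⁻¹ * (Φ N).collisionPairSum (Ioc 0 τ) (markK σ ψ χ N) z

/-! ## The weighted collision virial -/

/-- The weighted virial kernel `ε_N ‖Δv_i‖ (1 + ‖v_i‖ + ‖v_j‖)` of an ordered pair (nonnegative; the time
argument is unused and only gives the kernel the shape `collisionPairSum` expects). -/
def virialK (σ : ℝ) (N : ℕ) (_s : ℝ) (w : Cfg N) (i j : Fin (N + 1)) : ℝ :=
  Literature.MathematicalPhysics.KineticTheory.hsDiameter σ N * ‖dV N w i j‖ * (1 + ‖(w i).2‖ + ‖(w j).2‖)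

/-- `V_N(z, τ)`: the WEIGHTED COLLISION VIRIAL `(N+1)⁻¹ Σ_{ordered collisions in (0, τ]} ε_N ‖Δv_i‖ (1 + ‖v_i‖ + ‖v_j‖)`
of the orbit of `z` — `O(1)` under local equilibrium (collision frequency `≍ ε_N⁻¹` per particle, transfer
`≍ ε_N`); it prices the Taylor remainders of the flux form. -/
def virialW (σ : ℝ) (Φ : Flows σ) (N : ℕ) (z : Cfg N) (τ : ℝ) : ℝ :=
  ((N : ℝ) + 1)⁻¹ * (Φ N).collisionPairSum (Ioc 0 τ) (virialK σ N) z

/-! ## The statements [V] and [A'-chaos] -/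

/-- **[V] VIRIAL TIGHTNESS** at `(σ, profiles, Φ, t)`: the weighted collision virial over `(0, t]` is bounded
in local-Gibbs probability — `∃ K, P(V_N(t) > K) → 0`. An a-priori statement of the family of the density
window / exponential moments (a contact-scale "no sub-mesoscopic clustering" bound along the flow); exact
order `O(1)` at the invariant law. -/
def VirialTight (σ : ℝ) (a₀ θ₀ : T3 → ℝ) (u₀ : T3 → V3) (Φ : Flows σ) (t : ℝ) : Prop :=
  ∃ K : ℝ, Tendsto (fun N : ℕ =>
    Literature.MathematicalPhysics.KineticTheory.localGibbsLaw σ a₀ u₀ θ₀ N (Φ N) {z | K < virialW σ Φ N z t})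
    atTop (𝓝 0)

/-- **[A'-chaos] FLUX-FORM CHAOS** at `(σ, profiles, Φ, kernel, t, ψ, χ)`: uniformly in `τ ≤ t`,
`M_N − Sraw_N → 0` in local-Gibbs probability — the `‖Δv‖`-weighted empirical law of the collision marks
`(ω, v, v_*)`, tested against the two polynomial mark factors `ω⊗ω` (coefficients `∇ψ(s_c, x_i)`) and
`(V·ω)ω` (coefficients `∇χ(s_c, x_i)`), equals block by block the `⟪g,ω⟫²`-weighted average over UNIFORM
normals and the PRODUCT of the block one-body velocity law (`chaosAvg`, i.e. `rawK`). The pure chaos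
content of [A'] (no Taylor step, no test-function finite differences). -/
def FluxFormChaos (σ : ℝ) (a₀ θ₀ : T3 → ℝ) (u₀ : T3 → V3) (Φ : Flows σ) (φ : ℕ → T3 → ℝ) (t : ℝ)
    (ψ : ℝ → T3 → V3) (χ : ℝ → T3 → ℝ) : Prop :=
  ∀ δ : ℝ, 0 < δ → Tendsto (fun N : ℕ =>
    Literature.MathematicalPhysics.KineticTheory.localGibbsLaw σ a₀ u₀ θ₀ N (Φ N)
      {z | ∃ τ ∈ Icc 0 t, δ < |Mfun σ Φ ψ χ N z τ - Sraw σ Φ φ ψ χ N z τ|}) atTop (𝓝 0)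

/-! ## Bookkeeping lemmas (sorry-free) -/

/-- The weighted virial kernel is nonnegative for `σ ≥ 0`. -/
theorem virialK_nonneg : ∀ {σ : ℝ}, 0 ≤ σ → ∀ (N : ℕ) (s : ℝ) (w : Cfg N) (i j : Fin (N + 1)), 0 ≤ virialK σ N s w i j := by
  intro σ hσ N s w i j
  unfold virialK Literature.MathematicalPhysics.KineticTheory.hsDiameter
  positivity

/-- The centre-of-mass velocity is symmetric in the pair. -/
theorem Vcm_swap (N : ℕ) (w : Cfg N) (i j : Fin (N + 1)) : Vcm N w j i = Vcm N w i j := by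
  rw [Vcm, Vcm, add_comm]

/-! ## [V] in tightness form (appended 2026-08-16, lead c2) -/

/-- **[V] VIRIAL BOUNDEDNESS IN PROBABILITY** at `(σ, profiles, Φ, t)`: the family `(V_N(t))_N` of weighted
collision virials over `(0, t]` is TIGHT under the local Gibbs laws — for every `δ > 0` some level `K` is
exceeded with probability `≤ δ` for all large `N`. This (and not the fixed-level form `VirialTight`, which it
weakens: `VirialTight.virialBounded`) is what the reduction of [A'] consumes (`ε_N V_N → 0` in probability
needs only tightness, `ε_N → 0`), and it is the form an expectation bound `E[V_N(t)] ≤ C` delivers by Markov's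
inequality — as the equilibrium rung does (mean collision-flux bound under the invariant law,
cf. `lintegral_indicator_collisionMarkSum_le`). -/
def VirialBounded (σ : ℝ) (a₀ θ₀ : T3 → ℝ) (u₀ : T3 → V3) (Φ : Flows σ) (t : ℝ) : Prop :=
  ∀ δ : ℝ, 0 < δ → ∃ K : ℝ, ∀ᶠ N : ℕ in atTop,
    Literature.MathematicalPhysics.KineticTheory.localGibbsLaw σ a₀ u₀ θ₀ N (Φ N) {z | K < virialW σ Φ N z t} ≤
      ENNReal.ofReal δ

/-- The fixed-level form implies tightness. -/
theorem VirialTight.virialBounded {σ : ℝ} {a₀ θ₀ : T3 → ℝ} {u₀ : T3 → V3} {Φ : Flows σ} {t : ℝ}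
    (h : VirialTight σ a₀ θ₀ u₀ Φ t) : VirialBounded σ a₀ θ₀ u₀ Φ t := by
  intro δ hδ
  obtain ⟨K, hK⟩ := h
  refine ⟨K, ?_⟩
  have hpos : (0 : ℝ≥0∞) < ENNReal.ofReal δ := ENNReal.ofReal_pos.2 hδ
  exact ((tendsto_order.1 hK).2 _ hpos).mono fun N hN => hN.le

end

end Summit.AtomisticToContinuum.HydrodynamicLimit.Theorems.HemisphereAffineSlaving
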